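import Summits.QuantumFields.QCD.Theorems.QuarksAsStableActionStableActionBridgeSupertraceTransferForm
import Summits.QuantumFields.QCD.Theorems.QuarksAsStableActionStableActionBridgeSliceAssembleDict
import Summits.QuantumFields.YangMills.Theorems.PencilRigidityWeakCouplingHypercubicLimitStubTimeSlicing
import Literature.MathematicalPhysics.QuantumFieldTheory.QCDPhaseQuenched
import Literature.MathematicalPhysics.QuantumFieldTheory.TorusFreeTransfer

/-!
# The lattice-QCD Boltzmann integral as a cyclic kernel supertrace
(crux `QuarksAsStableAction.StableActionBridge`, item stmt-QuantumFields-9737, line `Sketch`;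
registered stub `qcd_boltzmann_integral_eq_cyclic_supertrace`, capstone C of the F3 dictionary)

For one flavour of `r = 1` Wilson quarks of bare mass `m > −1` in the fundamental representation of
`SU(3)` on the four-torus `(ℤ/N)⁴` (`N ≥ 1`), the Boltzmann integral of lattice QCD over the product
Haar measure of the links,

  `Z = ∫ e^{−β S_W(U)} det D_W[U] ∏_e dU_e`,

equals the CYCLIC KERNEL SUPERTRACE of `N` projected transfer kernels: slicing the torus across
Euclidean time (spatial links `Us t`, temporal links `gs t` leaving slice `t`),

  `Z = ∫∫ ∏_t K_β(Us t, (Us (t+1))^{gs t}) · STr ∏_t T̂_F(Us t) Γ(G_{gs t}) ∏_t dUs_t ∏_t dgs_t`,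

with `K_β` the temporal-gauge transfer kernel of the gauge field (`gaugeSliceKernel`, Smit (4.121),
(4.129)), `T̂_F` Smit's fermionic transfer operator (`fermionSliceOp`, Smit (6.91)), `Γ(G_g)` the
Fock-space gauge rotation (`fockGaugeAct`, Smit (4.125)–(4.127)) and `STr X = Σ_s (−1)^{#s} X_{ss}`
(periodic time for the fermions).  NO gauge fixing is used: the temporal links, put back as gauge
transformations of the next slice and integrated against Haar, ARE the Gauss-law projections `P̂₀`
(Smit (4.137)), so this is Lüscher's `Z = Tr (𝕋 P̂₀)^N` at kernel level (Lüscher 1977;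
Osterwalder–Seiler 1978 §2).

Assembly: the Yang–Mills time-slicing theorem `stub_timeSlicing` (the assembling map
`(Us, gs) ↦ U` is measure preserving from the product of the slice Haar measures to the torus Haar
measure, and `S_W(U) = Σ_t (S₃(Us t) + S_tm(Us t, gs t, Us (t+1)))`), the telescoped cyclic kernel
product `prod_gaugeSliceKernel_cycle_eq_exp`, and capstone B
`wilson_det_eq_supertrace_fermionSliceOp` (Lüscher's supertrace formula for `det D_W`) read through
the slicing dictionary `timeSlice_of_timeAssemble`; the integrand is continuous, so the integral is
transported along the assembling map (`integral_map`).  Pure theorem file (no definitions).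

References: M. Lüscher, Commun. Math. Phys. 54 (1977) 283 [Luscher1977, pp. 283–292];
K. Osterwalder, E. Seiler, Ann. Phys. 110 (1978) 440 [OsterwalderSeiler1978, §2]; J. Smit,
*Introduction to Quantum Fields on a Lattice* [Smit2023, §4.6 (4.127)–(4.137), §6.5 (6.87)–(6.91)].
-/

noncomputable section

namespace Summit.QuantumFields.QCD.Cruxes.StableActionBridge.Sketch

open MeasureTheory Matrix Literature.MathematicalPhysics.QuantumFieldTheory
  Literature.MathematicalPhysics.QuantumLattice
open Literature.Probability.LatticeModels (TorusSite)

namespace CyclicSupertrace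

/-- **The fermion determinant of the assembled field is the supertrace of the slice data.**  For
the four-torus field assembled from spatial slices `Us t` and temporal links `gs t`,
`det D_W = Σ_s (−1)^{#s} ⟨s| ∏_{i<N} T̂_F(Us i) Γ(G_{gs i}) |s⟩` (capstone B read through the
slicing dictionary). [cite: Luscher1977, pp. 283–292] [cite: Smit2023, §6.5 (6.87)–(6.91)] -/
theorem det_wilsonDirac_timeAssemble (N : ℕ) [NeZero N]
    (Us : ZMod N → GaugeConfig 3 N (Matrix.specialUnitaryGroup (Fin 3) ℂ))
    (gs : ZMod N → TorusSite 3 N → Matrix.specialUnitaryGroup (Fin 3) ℂ) (m : ℝ) (hm : -1 < m) :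
    (wilsonDirac (fundamentalRep (Fin 3))
        (fun e : Edge 4 N =>
          (Fin.cons (gs (e.1 0) (Fin.tail e.1)) (fun i : Fin 3 => Us (e.1 0) (Fin.tail e.1, i)) :
            Fin 4 → Matrix.specialUnitaryGroup (Fin 3) ℂ) e.2) m 1).det =
      ∑ s : Finset (SliceFermiIdx 1 N), (-1 : ℂ) ^ s.card *
        (((List.range N).map fun i : ℕ =>
            fermionSliceOp (Us (i : ZMod N)) (fun _ : Fin 1 => m) *
              fockGaugeAct (Nf := 1) (gs (i : ZMod N))).prod) s s := by
  rw [wilson_det_eq_supertrace_fermionSliceOp N _ m hm]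
  simp only [Fin.cons_succ, Fin.cons_zero, Fin.tail_cons, Prod.mk.eta]

/-- **The Boltzmann weight of the assembled field is the cyclic kernel product.**
`e^{−β S_W(U)} = ∏_t K_β(Us t, (Us (t+1))^{gs t})` for the field `U` assembled from `(Us, gs)`:
`S_W = Σ_t (S₃ + S_tm)` (`stub_timeSlicing`) and the half spatial actions of the kernels telescope
round the time cycle (`prod_gaugeSliceKernel_cycle_eq_exp`).
[cite: Smit2023, §4.6 (4.127)–(4.137)] [cite: OsterwalderSeiler1978, §2] -/
theorem exp_wilsonAction_timeAssemble (N : ℕ) [NeZero N] (β : ℝ)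
    (Us : ZMod N → GaugeConfig 3 N (Matrix.specialUnitaryGroup (Fin 3) ℂ))
    (gs : ZMod N → TorusSite 3 N → Matrix.specialUnitaryGroup (Fin 3) ℂ) :
    Real.exp (-(β * wilsonAction (fundamentalRep (Fin 3))
        (fun e : Edge 4 N =>
          (Fin.cons (gs (e.1 0) (Fin.tail e.1)) (fun i : Fin 3 => Us (e.1 0) (Fin.tail e.1, i)) :
            Fin 4 → Matrix.specialUnitaryGroup (Fin 3) ℂ) e.2))) =
      ∏ t : ZMod N, gaugeSliceKernel β (Us t) (gaugeTransform (gs t) (Us (t + 1))) := by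
  rw [prod_gaugeSliceKernel_cycle_eq_exp N β Us gs]
  exact congrArg (fun x : ℝ => Real.exp (-(β * x)))
    ((Summit.QuantumFields.YangMills.Theorems.WeakCouplingHypercubicLimit.TraceNormColdPressure.stub_timeSlicing
      N (Matrix.specialUnitaryGroup (Fin 3) ℂ) (fundamentalRep (Fin 3))).2 Us gs)

/-- **Pointwise identity behind capstone C.**  At the field assembled from `p = (Us, gs)` the
one-flavour QCD Boltzmann integrand `e^{−β S_W(U)} det D_W[U]` is the cyclic kernel product times the
supertrace of the time-ordered product of projected fermionic transfer operators,
`(∏_t K_β(Us t, (Us (t+1))^{gs t})) · Σ_s (−1)^{#s} ⟨s| ∏_{i<N} T̂_F(Us i) Γ(G_{gs i}) |s⟩`.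
[cite: Luscher1977, pp. 283–292] [cite: Smit2023, §4.6 (4.127)–(4.137), §6.5 (6.87)–(6.91)] -/
theorem integrand_timeAssemble (N : ℕ) [NeZero N] (β m : ℝ) (hm : -1 < m)
    (p : (ZMod N → GaugeConfig 3 N (Matrix.specialUnitaryGroup (Fin 3) ℂ)) ×
      (ZMod N → TorusSite 3 N → Matrix.specialUnitaryGroup (Fin 3) ℂ)) :
    (Real.exp (-(β * wilsonAction (fundamentalRep (Fin 3))
        (fun e : Edge 4 N =>
          (Fin.cons (p.2 (e.1 0) (Fin.tail e.1)) (fun i : Fin 3 => p.1 (e.1 0) (Fin.tail e.1, i)) :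
            Fin 4 → Matrix.specialUnitaryGroup (Fin 3) ℂ) e.2))) : ℂ) *
        (wilsonDirac (fundamentalRep (Fin 3))
          (fun e : Edge 4 N =>
            (Fin.cons (p.2 (e.1 0) (Fin.tail e.1)) (fun i : Fin 3 => p.1 (e.1 0) (Fin.tail e.1, i)) :
              Fin 4 → Matrix.specialUnitaryGroup (Fin 3) ℂ) e.2) m 1).det =
      ((∏ t : ZMod N, gaugeSliceKernel β (p.1 t) (gaugeTransform (p.2 t) (p.1 (t + 1))) : ℝ) : ℂ) *
        ∑ s : Finset (SliceFermiIdx 1 N), (-1 : ℂ) ^ s.card *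
          (((List.range N).map fun i : ℕ =>
              fermionSliceOp (p.1 (i : ZMod N)) (fun _ : Fin 1 => m) *
                fockGaugeAct (Nf := 1) (p.2 (i : ZMod N))).prod) s s := by
  rw [exp_wilsonAction_timeAssemble N β p.1 p.2, det_wilsonDirac_timeAssemble N p.1 p.2 m hm]

/-- The one-flavour QCD Boltzmann integrand `U ↦ e^{−β S_W(U)} det D_W[U]` is continuous on the
compact configuration space `SU(3)^{edges}` (the Wilson action and the Wilson–Dirac matrix are
continuous in the links). [folklore] -/
theorem continuous_integrand (N : ℕ) [NeZero N] (β m : ℝ) :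
    Continuous fun U : GaugeConfig 4 N (Matrix.specialUnitaryGroup (Fin 3) ℂ) =>
      (Real.exp (-(β * wilsonAction (fundamentalRep (Fin 3)) U)) : ℂ) *
        (wilsonDirac (fundamentalRep (Fin 3)) U m 1).det :=
  (Complex.continuous_ofReal.comp (Real.continuous_exp.comp
    (((Literature.MathematicalPhysics.QuantumFieldTheory.continuous_wilsonAction
      (fundamentalRep (Fin 3)) (continuous_fundamentalRep (Fin 3))).const_mul β).neg))).mul
    (continuous_wilsonDirac (fundamentalRep (Fin 3)) (continuous_fundamentalRep (Fin 3)) m 1).matrix_det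

end CyclicSupertrace

/-- **Capstone C of the F3 dictionary (stub `qcd_boltzmann_integral_eq_cyclic_supertrace` of line
`Sketch`): the lattice-QCD Boltzmann integral is a cyclic kernel supertrace.**  For one flavour of
`r = 1` Wilson quarks of bare mass `m > −1` (fundamental representation of `SU(3)`) on the four-torus
`(ℤ/N)⁴`,
`∫ e^{−β S_W(U)} det D_W[U] dU = ∫∫ ∏_t K_β(Us t, (Us (t+1))^{gs t}) · STr ∏_t T̂_F(Us t) Γ(G_{gs t}) dUs dgs`:
Lüscher's `Z = Tr (𝕋 P̂₀)^N` at kernel level, without gauge fixing — the Haar integrals over the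
temporal links `gs t` are the Gauss-law projections `P̂₀`.
[cite: Luscher1977, pp. 283–292] [cite: OsterwalderSeiler1978, §2]
[cite: Smit2023, §4.6 (4.127)–(4.137), §6.5 (6.87)–(6.91)] -/
theorem qcd_boltzmann_integral_eq_cyclic_supertrace : ∀ (N : ℕ) [NeZero N] (β m : ℝ), -1 < m → ∫ U : GaugeConfig 4 N (Matrix.specialUnitaryGroup (Fin 3) ℂ), (Real.exp (-(β * wilsonAction (fundamentalRep (Fin 3)) U)) : ℂ) * (wilsonDirac (fundamentalRep (Fin 3)) U m 1).det ∂(Measure.pi fun _ : Edge 4 N => haarProbability (Matrix.specialUnitaryGroup (Fin 3) ℂ)) = ∫ p : (ZMod N → GaugeConfig 3 N (Matrix.specialUnitaryGroup (Fin 3) ℂ)) × (ZMod N → TorusSite 3 N → Matrix.specialUnitaryGroup (Fin 3) ℂ), ((∏ t : ZMod N, gaugeSliceKernel β (p.1 t) (gaugeTransform (p.2 t) (p.1 (t + 1))) : ℝ) : ℂ) * ∑ s : Finset (SliceFermiIdx 1 N), (-1 : ℂ) ^ s.card * (((List.range N).map fun i : ℕ => fermionSliceOp (p.1 (i : ZMod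 N)) (fun _ : Fin 1 => m) * fockGaugeAct (Nf := 1) (p.2 (i : ZMod N))).prod) s s ∂((Measure.pi fun _ : ZMod N => Measure.pi fun _ : Edge 3 N => haarProbability (Matrix.specialUnitaryGroup (Fin 3) ℂ)).prod (Measure.pi fun _ : ZMod N => Measure.pi fun _ : TorusSite 3 N => haarProbability (Matrix.specialUnitaryGroup (Fin 3) ℂ))) := by
  intro N _ β m hm
  -- T1: the assembling map `(Us, gs) ↦ U` is measure preserving (slice Haar ↦ torus Haar)
  obtain ⟨hasm, -⟩ :=
    Summit.QuantumFields.YangMills.Theorems.WeakCouplingHypercubicLimit.TraceNormColdPressure.stub_timeSlicing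
      N (Matrix.specialUnitaryGroup (Fin 3) ℂ) (fundamentalRep (Fin 3))
  -- transport the torus integral along the assembling map
  rw [← hasm.map_eq, integral_map hasm.measurable.aemeasurable
    (CyclicSupertrace.continuous_integrand N β m).aestronglyMeasurable]
  -- and identify the integrands pointwise
  exact integral_congr_ae (ae_of_all _ fun p => CyclicSupertrace.integrand_timeAssemble N β m hm p)

end Summit.QuantumFields.QCD.Cruxes.StableActionBridge.Sketch

end
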